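import Literature.Barriers.NavierStokesRegularity.NavierStokesInequalityStructureCopies
import Literature.Barriers.NavierStokesRegularity.NavierStokesInequalityRingField
import HarnessLib

/-!
# The joint pressure interaction function `H = F + F' + F''` (Ożański 2017, §5 before §5.1, §5.2)

Barrier catalogue support file for `NavierStokesRegularity` (D-0021), on the discharge path of
fact C′ `Literature.Barriers.NavierStokesRegularity.NSICantorArrangementExists` (and of fact C
`NSIArrangementExists`): the symmetry facts of §5 (opening) and the "simple geometric argument"
of §5.2 of W. S. Ożański, arXiv:1709.00602v4, built on the copies and the additivity of
`NavierStokesInequalityStructureCopies` and on Lemma 3.5 (`NavierStokesInequalityInteractionDecay`):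

* **Lemma 3.2 (ii) / (5.4)**: for planar data with `v_z` even, `v_r` odd and `f` even in the
  axial variable, the planar pressure `p[v,f]` is even and the axial component of
  `F[v,f] = ∇p[0,f] - ∇p[v,f]` is odd in `z` (`pressureInteraction_reflect`); in particular
  `F_axial(0,-s) = -F_axial(0,s)` on the axis ((5.4): "`F₁(-x₁,0) = -F₁(x₁,0)`"), whence
  `min F_axial(0,·) = -B` ((5.5)). Proof: conjugating `u[v,f]` by the reflection `z ↦ -z` of `ℝ³`
  gives `u[-v,f]`, and `p[-v,f] = p[v,f]` (Lemma 3.2 (i), `planePressure_neg`).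
* **Lemma 3.5 (iv)**: `F_radial = 0` on the axis (`pressureInteraction_fst_axis`), from the
  axisymmetry of `p*` under the rotation by `π`.
* **§5.2 (i)–(vi)** (`exists_interactionStack`): given a structure on `U ⊆ {1/8 ≤ r ≤ 7/8}` with
  `F_axial` odd on the axis and `v_z ≢ 0`, there are two copies `U^{a',r'}`, `U^{a'',r''}` with
  amplitudes `(s')²/r' = 2`, `(s'')²/r'' = 4`, pairwise disjoint closures, such that
  `H = F + F^{a',r',s'} + F^{a'',r'',s''}` has (i) `H_axial(0,A) = 7B`, (ii) `H_axial ≥ -1.005B` on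
  the axis, (iii) `|H(q)| ≤ 2C/|q|⁴` for `|q| ≥ 2|A|`, and for every `κ > 0` an `E > 0` with (iv) the
  strip `{0 < r < E}` below the three sets, (v) `H_axial ≥ -1.01B` on the strip, (vi)
  `H_axial ≥ 6.99B` on `{|z - A| ≤ κE, 0 < r < E}`.

Tree coordinates as in the sibling files: `q = (r, z)`, axis `= x̂₂`, Ożański's `F₁ = (F q).2`,
`F₂ = (F q).1`, sup norm on `ℝ × ℝ`.

## References

* W. S. Ożański, arXiv:1709.00602v4 (2017/2019), Lemma 3.2 (i)–(ii), Lemma 3.5 (ii)–(iv), §5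
  ((5.2)–(5.5)), §5.2 ((5.8)–(5.13), (i)–(vi), Fig. 7). [`Ozanski2017NSISingular`]
* V. Scheffer, Comm. Math. Phys. 110 (1987), 525–551, §4 (Lemmas 4.1–4.6). [`Scheffer1987`]
* V. Scheffer, Comm. Math. Phys. 101 (1985), 47–85, §4, Lemma 6.2. [`Scheffer1985`]
-/

noncomputable section

open MeasureTheory Set Function Filter Topology TopologicalSpace WithLp Metric Real
open scoped ENNReal InnerProductSpace RealInnerProductSpace ContDiff

namespace Literature.Barriers.NavierStokesRegularity

open Literature.Analysis.FluidPDE Literature.Analysis.Calculus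

/-- Local notation for physical space `ℝ³ = EuclideanSpace ℝ (Fin 3)`. -/
local notation "ℝ³" => EuclideanSpace ℝ (Fin 3)

/-! ### The axial reflection `z ↦ -z` -/

/-- The reflection `(x₀, x₁, x₂) ↦ (x₀, x₁, -x₂)` in the plane `{x₂ = 0}` perpendicular to the axis
(Ożański's `x₁ ↦ -x₁`), as a linear isometry equivalence of `ℝ³`. [folklore] -/
def reflZ : ℝ³ ≃ₗᵢ[ℝ] ℝ³ where
  toFun x := toLp 2 ![x 0, x 1, -x 2]
  invFun x := toLp 2 ![x 0, x 1, -x 2]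
  map_add' y z := by
    ext i; fin_cases i <;> simp; ring
  map_smul' c y := by
    ext i; fin_cases i <;> simp
  left_inv y := by
    ext i; fin_cases i <;> simp
  right_inv y := by
    ext i; fin_cases i <;> simp
  norm_map' x := by
    rw [EuclideanSpace.norm_eq, EuclideanSpace.norm_eq]
    congr 1
    simp [Fin.sum_univ_three]

/-- Components of the reflection. [folklore] -/
@[simp] theorem reflZ_apply_zero (x : ℝ³) : reflZ x 0 = x 0 := rfl

/-- Components of the reflection. [folklore] -/
@[simp] theorem reflZ_apply_one (x : ℝ³) : reflZ x 1 = x 1 := rfl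

/-- Components of the reflection. [folklore] -/
@[simp] theorem reflZ_apply_two (x : ℝ³) : reflZ x 2 = -x 2 := rfl

/-- `reflZ` is an involution. [folklore] -/
@[simp] theorem reflZ_reflZ (x : ℝ³) : reflZ (reflZ x) = x := by
  ext i; fin_cases i <;> simp

/-- `reflZ⁻¹ = reflZ`. [folklore] -/
@[simp] theorem reflZ_symm : reflZ.symm = reflZ := rfl

/-- The reflection preserves the distance to the axis. [folklore] -/
theorem cylRadius_reflZ (x : ℝ³) : cylRadius (reflZ x) = cylRadius x := by
  simp [cylRadius]

/-- Meridian coordinates of the reflected point: `(r, -z)`. [folklore] -/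
theorem meridian_reflZ (x : ℝ³) : meridian (reflZ x) = ((meridian x).1, -(meridian x).2) := by
  simp [meridian, cylRadius_reflZ]

/-- The radial frame vector is fixed by `reflZ` (both the point and the vector). [folklore] -/
theorem eR_reflZ (x : ℝ³) : eR (reflZ x) = eR x := by
  ext i; fin_cases i <;> simp [eR, cylRadius_reflZ]

/-- `reflZ (ρ̂ x) = ρ̂ x`. [folklore] -/
theorem reflZ_eR (x : ℝ³) : reflZ (eR x) = eR x := by
  ext i; fin_cases i <;> simp [eR]

/-- The angular frame vector is fixed by `reflZ`. [folklore] -/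
theorem eTheta_reflZ (x : ℝ³) : eTheta (reflZ x) = eTheta x := by
  ext i; fin_cases i <;> simp [eTheta, cylRadius_reflZ]

/-- `reflZ (φ̂ x) = φ̂ x`. [folklore] -/
theorem reflZ_eTheta (x : ℝ³) : reflZ (eTheta x) = eTheta x := by
  ext i; fin_cases i <;> simp [eTheta]

/-- `reflZ x̂₂ = -x̂₂`. [folklore] -/
theorem reflZ_eZ : reflZ eZ = -eZ := by
  ext i; fin_cases i <;> simp [eZ, reflZ]

/-- `reflZ (r, 0, z) = (r, 0, -z)`. [folklore] -/
theorem reflZ_meridianPoint (q : ℝ × ℝ) : reflZ (meridianPoint q) = meridianPoint (q.1, -q.2) := by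
  ext i; fin_cases i <;> simp [meridianPoint, reflZ]

/-! ### Lemma 3.2 (ii): parity of `p[v,f]` and of `F[v,f]` for symmetric data -/

section Parity

variable {v : ℝ × ℝ → ℝ × ℝ} {f : ℝ × ℝ → ℝ}

/-- **Conjugating `u[v,f]` by the axial reflection reverses the poloidal part** when `v_r` is odd,
`v_z` even and `f` even in `z` (Ożański (5.2)–(5.3)): `u[-v,f](x) = reflZ (u[v,f](reflZ x))`.
[cite: Ozanski2017NSISingular, Lemma 3.2 (ii) and §5 (5.2)–(5.3)] -/
theorem swirlField_neg_eq_conj_reflZ (hv₁ : ∀ q : ℝ × ℝ, (v (q.1, -q.2)).1 = -(v q).1)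
    (hv₂ : ∀ q : ℝ × ℝ, (v (q.1, -q.2)).2 = (v q).2) (hf : ∀ q : ℝ × ℝ, f (q.1, -q.2) = f q)
    (x : ℝ³) : swirlField (-v) f x = reflZ (swirlField v f (reflZ x)) := by
  rw [swirlField, swirlField, meridian_reflZ, eR_reflZ, eTheta_reflZ, map_add, map_add, map_smul,
    map_smul, map_smul, reflZ_eR, reflZ_eTheta, reflZ_eZ, hv₁, hv₂, hf]
  simp only [Pi.neg_apply, Prod.fst_neg, Prod.snd_neg, smul_neg, neg_smul, even_two,
    Even.neg_pow]

/-- **Lemma 3.2 (ii): `p[v,f]` is even in the axial variable** for `v_r` odd, `v_z` even, `f` even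
(printed: "`p[v,f](x₁,ρ) = p[v,f](-x₁,ρ)`"). [cite: Ozanski2017NSISingular, Lemma 3.2 (ii)] -/
theorem planePressure_reflect (hv₁ : ∀ q : ℝ × ℝ, (v (q.1, -q.2)).1 = -(v q).1)
    (hv₂ : ∀ q : ℝ × ℝ, (v (q.1, -q.2)).2 = (v q).2) (hf : ∀ q : ℝ × ℝ, f (q.1, -q.2) = f q)
    (q : ℝ × ℝ) : planePressure v f (q.1, -q.2) = planePressure v f q := by
  have h1 : swirlField (-v) f = fun y => reflZ (swirlField v f (reflZ.symm y)) := by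
    funext y; rw [swirlField_neg_eq_conj_reflZ hv₁ hv₂ hf, reflZ_symm]
  have h2 := normalisedPressure_conj_linearIsometryEquiv reflZ (swirlField v f) (meridianPoint q)
  rw [← h1, reflZ_symm, reflZ_meridianPoint] at h2
  rw [planePressure, ← h2, ← planePressure, planePressure_neg]

/-- `p[0,f]` is even in `z` for `f` even. [cite: Ozanski2017NSISingular, Lemma 3.2 (ii)] -/
theorem planePressure_zero_reflect (hf : ∀ q : ℝ × ℝ, f (q.1, -q.2) = f q) (q : ℝ × ℝ) :
    planePressure 0 f (q.1, -q.2) = planePressure 0 f q :=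
  planePressure_reflect (v := 0) (fun _ => by simp) (fun _ => rfl) hf q

/-- The planar reflection `N (r, z) = (r, -z)` as a continuous linear equivalence. [folklore] -/
def reflPlane : (ℝ × ℝ) ≃L[ℝ] ℝ × ℝ :=
  (ContinuousLinearEquiv.refl ℝ ℝ).prodCongr (ContinuousLinearEquiv.neg ℝ)

/-- Unfolding `reflPlane`. [folklore] -/
@[simp] theorem reflPlane_apply (q : ℝ × ℝ) : reflPlane q = (q.1, -q.2) := rfl

/-- For a function even in `z`, `∂ᵣ` is even and `∂_z` is odd in `z` (no differentiability needed:
the junk values are reflected as well). [folklore] -/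
theorem derivR_derivZ_of_even {g : ℝ × ℝ → ℝ} (hg : ∀ q : ℝ × ℝ, g (q.1, -q.2) = g q) (q : ℝ × ℝ) :
    derivR g (q.1, -q.2) = derivR g q ∧ derivZ g (q.1, -q.2) = -derivZ g q := by
  have hcomp : g ∘ reflPlane = g := funext fun q => hg q
  have key : fderiv ℝ g q = (fderiv ℝ g (reflPlane q)).comp (reflPlane : ℝ × ℝ →L[ℝ] ℝ × ℝ) := by
    rw [← reflPlane.comp_right_fderiv, hcomp]
  have e1 : derivR g q = derivR g (q.1, -q.2) := by
    rw [derivR, key]; simp [derivR]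
  have e2 : derivZ g q = -derivZ g (q.1, -q.2) := by
    rw [derivZ, key]
    simp only [ContinuousLinearMap.coe_comp, ContinuousLinearEquiv.coe_coe, Function.comp_apply,
      reflPlane_apply, derivZ]
    rw [show ((0 : ℝ), (-1 : ℝ)) = -((0 : ℝ), (1 : ℝ)) by simp, map_neg]
  exact ⟨e1.symm, by rw [e2, neg_neg]⟩

/-- **The axial component of `F[v,f]` is odd, the radial one even, in `z`** for symmetric data
(Ożański (5.4) off the axis as well). [cite: Ozanski2017NSISingular, §5 (5.4) and Lemma 3.2 (ii)] -/
theorem pressureInteraction_reflect (hv₁ : ∀ q : ℝ × ℝ, (v (q.1, -q.2)).1 = -(v q).1)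
    (hv₂ : ∀ q : ℝ × ℝ, (v (q.1, -q.2)).2 = (v q).2) (hf : ∀ q : ℝ × ℝ, f (q.1, -q.2) = f q)
    (q : ℝ × ℝ) :
    pressureInteraction v f (q.1, -q.2) =
      ((pressureInteraction v f q).1, -(pressureInteraction v f q).2) := by
  obtain ⟨a₀, b₀⟩ := derivR_derivZ_of_even (planePressure_zero_reflect (f := f) hf) q
  obtain ⟨a₁, b₁⟩ := derivR_derivZ_of_even (planePressure_reflect hv₁ hv₂ hf) q
  simp only [pressureInteraction, a₀, b₀, a₁, b₁]
  ring_nf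

/-- **(5.4): `F_axial(0,-s) = -F_axial(0,s)`** on the axis for symmetric data.
[cite: Ozanski2017NSISingular, §5 (5.4)] -/
theorem pressureInteraction_snd_axis_odd (hv₁ : ∀ q : ℝ × ℝ, (v (q.1, -q.2)).1 = -(v q).1)
    (hv₂ : ∀ q : ℝ × ℝ, (v (q.1, -q.2)).2 = (v q).2) (hf : ∀ q : ℝ × ℝ, f (q.1, -q.2) = f q)
    (s : ℝ) : (pressureInteraction v f (0, -s)).2 = -(pressureInteraction v f (0, s)).2 := by
  have := pressureInteraction_reflect hv₁ hv₂ hf (0, s)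
  simpa using congrArg Prod.snd this

end Parity

/-! ### Lemma 3.5 (iv): `F_radial = 0` on the axis -/

namespace IsNSIStructure

variable {U : Set (ℝ × ℝ)} {v : ℝ × ℝ → ℝ × ℝ} {f φ : ℝ × ℝ → ℝ}

/-- **Lemma 3.5 (iv)** (Ożański 2017): `F₂(x₁, 0) = 0` — the radial component of `F[v,f]`
vanishes on the axis (here `(pressureInteraction v f (0,s)).1 = 0`): `p*` is axisymmetric, hence
invariant under the rotation by `π`, which fixes the axis and reverses `x̂₀` ((3.24)).
[cite: Ozanski2017NSISingular, Lemma 3.5 (iv) and (3.24)] -/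
theorem pressureInteraction_fst_axis (h : IsNSIStructure U v f φ) (s : ℝ) :
    (pressureInteraction v f (0, s)).1 = 0 := by
  have key : ∀ {w : ℝ × ℝ → ℝ × ℝ}, fderiv ℝ (normalisedPressure (swirlField w f)) (meridianPoint (0, s))
      (EuclideanSpace.single (0 : Fin 3) (1 : ℝ)) = 0 := by
    intro w
    have hsym := isAxisymmetricScalar_normalisedPressure_swirlField w f
    have hcomp : normalisedPressure (swirlField w f) ∘ (rotZLIE π : ℝ³ →L[ℝ] ℝ³) =
        normalisedPressure (swirlField w f) := by
      funext x
      exact hsym π x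
    refine fderiv_apply_eq_zero_of_comp_eq (rotZLIE π : ℝ³ →L[ℝ] ℝ³) hcomp ?_ ?_
    · ext i; fin_cases i <;> simp [rotZ, meridianPoint]
    · ext i; fin_cases i <;> simp [rotZ]
  rw [h.pressureInteraction_eq]
  simp only [key, sub_self]

end IsNSIStructure

/-! ### The symmetric base field `v` on `U = (1/8, 7/8) × (-1, 1)` (Ożański (5.1)–(5.3)) -/

namespace BaseField

/-- The radial bump `β(r)` (plateau on `[3/8, 5/8]`, supported in `[1/4, 3/4]`). [folklore] -/
def β : ℝ → ℝ := plateauProfile (1 / 4) (3 / 4) (1 / 8)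

/-- The axial bump `γ(z)`, even in `z` (plateau on `[-1/4, 1/4]`, supported in `[-1/2, 1/2]`). [folklore] -/
def γ : ℝ → ℝ := plateauProfile (-(1 / 2)) (1 / 2) (1 / 4)

/-- **The base field** `v = r⁻¹ ∇⊥(β(r)γ(z)) = (-β(r)γ'(z)/r, β'(r)γ(z)/r)` (a concrete choice of
Ożański's `v ∈ C_0^∞(U; ℝ²)` with (5.2)–(5.3): `div(x₂ v) = 0`, `v₁` even and `v₂` odd in `x₁`;
cf. his example `x₂⁻¹ J((-(x₂-1/2), x₁)χ)`). [cite: Ozanski2017NSISingular, §5 (5.1)–(5.3)] -/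
def field (q : ℝ × ℝ) : ℝ × ℝ :=
  (-(β q.1 * q.1⁻¹) * deriv γ q.2, deriv β q.1 * q.1⁻¹ * γ q.2)

/-- `β` is smooth. [folklore] -/
theorem contDiff_β : ContDiff ℝ ∞ β := contDiff_plateauProfile _ _ _

/-- `γ` is smooth. [folklore] -/
theorem contDiff_γ : ContDiff ℝ ∞ γ := contDiff_plateauProfile _ _ _

/-- `β = 0` on `(-∞, 1/4]`. [folklore] -/
theorem β_eq_zero {t : ℝ} (ht : t ≤ 1 / 4) : β t = 0 := by
  unfold β; exact plateauProfile_eq_zero_of_le (by norm_num) ht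

/-- `β' = 0` off `[1/4, 3/4]`. [folklore] -/
theorem deriv_β_eq_zero {t : ℝ} (ht : t ∉ Icc (1 / 4 : ℝ) (3 / 4)) : deriv β t = 0 := by
  unfold β; exact deriv_plateauProfile_eq_zero_of_notMem (η := 1 / 8) (by norm_num) ht

/-- `γ` is even. [folklore] -/
theorem γ_neg (z : ℝ) : γ (-z) = γ z := by
  have := plateauProfile_symm (-(1 / 2)) (1 / 2) (1 / 4) z
  rw [show -(1 / 2 : ℝ) + 1 / 2 - z = -z by ring] at this
  unfold γ; exact this

/-- `γ'` is odd. [folklore] -/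
theorem deriv_γ_neg (z : ℝ) : deriv γ (-z) = -deriv γ z := by
  have h : (fun x => γ (-x)) = γ := funext γ_neg
  have := deriv_comp_neg (f := γ) (-z)
  rw [neg_neg] at this
  rw [← this, h]

/-- `γ(0) = 1`. [folklore] -/
theorem γ_zero : γ 0 = 1 := by
  unfold γ; exact plateauProfile_eq_one (by norm_num) ⟨by norm_num, by norm_num⟩

/-- **`v ∈ C^∞`**. [cite: Ozanski2017NSISingular, §5 (before (5.2))] -/
theorem contDiff_field : ContDiff ℝ ∞ field := by
  have h1 : ContDiff ℝ ∞ fun q : ℝ × ℝ => β q.1 * q.1⁻¹ :=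
    contDiff_mul_inv_fst_of_eq_zero (contDiff_β.comp contDiff_fst) (by norm_num : (0 : ℝ) < 1 / 4)
      fun q hq => β_eq_zero hq.le
  have h2 : ContDiff ℝ ∞ fun q : ℝ × ℝ => deriv β q.1 * q.1⁻¹ :=
    contDiff_mul_inv_fst_of_eq_zero ((contDiff_infty_iff_deriv.1 contDiff_β).2.comp contDiff_fst)
      (by norm_num : (0 : ℝ) < 1 / 4) fun q hq => deriv_β_eq_zero fun hm => by linarith [hm.1, hq]
  exact (h1.neg.mul ((contDiff_infty_iff_deriv.1 contDiff_γ).2.comp contDiff_snd)).prodMk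
    (h2.mul (contDiff_γ.comp contDiff_snd))

/-- `supp v ⊆ [1/4, 3/4] × [-1/2, 1/2]`. [folklore] -/
theorem tsupport_field_subset : tsupport field ⊆ Icc (1 / 4 : ℝ) (3 / 4) ×ˢ Icc (-(1 / 2) : ℝ) (1 / 2) := by
  refine closure_minimal (fun q hq => ?_) (isClosed_Icc.prod isClosed_Icc)
  rw [mem_support, Ne, Prod.ext_iff, not_and_or] at hq
  simp only [field, Prod.fst_zero, Prod.snd_zero] at hq
  have hγs := support_plateauProfile (a := -(1 / 2 : ℝ)) (b := 1 / 2) (η := 1 / 4) (by norm_num)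
  have hβs := support_plateauProfile (a := (1 / 4 : ℝ)) (b := 3 / 4) (η := 1 / 8) (by norm_num)
  constructor
  · -- the radial coordinate: `β ≠ 0` or `β' ≠ 0`
    by_contra hn
    have h1 : β q.1 = 0 := by
      have : q.1 ∉ Function.support β := by
        unfold β; rw [hβs]; exact fun hm => hn ⟨hm.1.le, hm.2.le⟩
      exact notMem_support.1 this
    have h2 : deriv β q.1 = 0 := deriv_β_eq_zero hn
    exact hq.elim (fun h' => h' (by simp [h1])) (fun h' => h' (by simp [h2]))
  · -- the axial coordinate: `γ ≠ 0` or `γ' ≠ 0`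
    by_contra hn
    have h1 : γ q.2 = 0 := by
      have : q.2 ∉ Function.support γ := by
        unfold γ; rw [hγs]; exact fun hm => hn ⟨hm.1.le, hm.2.le⟩
      exact notMem_support.1 this
    have h2 : deriv γ q.2 = 0 := by
      unfold γ; exact deriv_plateauProfile_eq_zero_of_notMem (η := 1 / 4) (by norm_num) hn
    exact hq.elim (fun h' => h' (by simp [h2])) (fun h' => h' (by simp [h1]))

/-- `supp v ⊆ U = (1/8, 7/8) × (-1, 1)`. [cite: Ozanski2017NSISingular, §5 (5.1)] -/
theorem tsupport_field_subset_rect : tsupport field ⊆ rect (1 / 8) (7 / 8) (-1) 1 :=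
  tsupport_field_subset.trans fun q hq => by
    simp only [mem_prod, mem_Icc] at hq
    simp only [mem_rect]
    exact ⟨⟨by linarith [hq.1.1], by linarith [hq.1.2]⟩, by linarith [hq.2.1], by linarith [hq.2.2]⟩

/-- **(5.3): `div(r v) = 0`** (`r v_r = -βγ'`, `r v_z = β'γ`). [cite: Ozanski2017NSISingular, §5 (5.3)] -/
theorem div_field (q : ℝ × ℝ) :
    derivR (fun q' : ℝ × ℝ => q'.1 * (field q').1) q + derivZ (fun q' : ℝ × ℝ => q'.1 * (field q').2) q = 0 := by
  have hβ : Differentiable ℝ β := contDiff_β.differentiable (by simp)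
  have hγ : Differentiable ℝ γ := contDiff_γ.differentiable (by simp)
  have hβ' : Differentiable ℝ (deriv β) := (contDiff_infty_iff_deriv.1 contDiff_β).2.differentiable (by simp)
  have hγ' : Differentiable ℝ (fun z => -deriv γ z) :=
    ((contDiff_infty_iff_deriv.1 contDiff_γ).2.differentiable (by simp)).neg
  have e1 : (fun q' : ℝ × ℝ => q'.1 * (field q').1) = fun q' => β q'.1 * (-deriv γ q'.2) := by
    funext q'
    simp only [field]
    rcases eq_or_ne q'.1 0 with h0 | h0
    · rw [h0, β_eq_zero (by norm_num)]; simp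
    · field_simp
  have e2 : (fun q' : ℝ × ℝ => q'.1 * (field q').2) = fun q' => deriv β q'.1 * γ q'.2 := by
    funext q'
    simp only [field]
    rcases eq_or_ne q'.1 0 with h0 | h0
    · rw [h0, deriv_β_eq_zero (fun hm => by norm_num at hm)]; simp
    · field_simp
  rw [e1, e2, derivR_mul_sep hβ hγ', derivZ_mul_sep hβ' hγ]
  simp

/-- **(5.2): `v_r` is odd in `z`** (printed: `v₂(-x₁,x₂) = -v₂(x₁,x₂)`). [cite: Ozanski2017NSISingular, §5 (5.2)] -/
theorem field_fst_reflect (q : ℝ × ℝ) : (field (q.1, -q.2)).1 = -(field q).1 := by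
  simp [field, deriv_γ_neg]

/-- **(5.2): `v_z` is even in `z`** (printed: `v₁(-x₁,x₂) = v₁(x₁,x₂)`). [cite: Ozanski2017NSISingular, §5 (5.2)] -/
theorem field_snd_reflect (q : ℝ × ℝ) : (field (q.1, -q.2)).2 = (field q).2 := by
  simp [field, γ_neg]

/-- **`v_z ≢ 0`** (so that `D > 0`, Lemma 3.5 (i)–(ii)): by the mean value theorem `β' = 4` somewhere
on `(1/4, 1/2)`, where `γ(0) = 1`. [cite: Ozanski2017NSISingular, Lemma 3.5 (hypothesis `v₁ ≢ 0`)] -/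
theorem exists_field_snd_ne_zero : ∃ q : ℝ × ℝ, (field q).2 ≠ 0 := by
  have hβ : Differentiable ℝ β := contDiff_β.differentiable (by simp)
  obtain ⟨ρ₀, hρ₀, hd⟩ := exists_deriv_eq_slope β (by norm_num : (1 / 4 : ℝ) < 1 / 2)
    hβ.continuous.continuousOn (hβ.differentiableOn)
  have hb1 : β (1 / 2) = 1 := by
    unfold β; exact plateauProfile_eq_one (by norm_num) ⟨by norm_num, by norm_num⟩
  have hb0 : β (1 / 4) = 0 := β_eq_zero le_rfl
  rw [hb1, hb0] at hd
  norm_num at hd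
  refine ⟨(ρ₀, 0), ?_⟩
  have hρ : ρ₀ ≠ 0 := by linarith [hρ₀.1]
  simp [field, γ_zero, hd, hρ]

/-- `v` is bounded: `|v|² < μ₀²` for some `μ₀ > 0`. [folklore] -/
theorem exists_sq_lt : ∃ μ₀ : ℝ, 0 < μ₀ ∧ ∀ q : ℝ × ℝ, (field q).1 ^ 2 + (field q).2 ^ 2 < μ₀ ^ 2 := by
  have hc : Continuous field := contDiff_field.continuous
  have hK : IsCompact (Icc (1 / 4 : ℝ) (3 / 4) ×ˢ Icc (-(1 / 2) : ℝ) (1 / 2)) := isCompact_Icc.prod isCompact_Icc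
  have hsupp : HasCompactSupport field := hK.of_isClosed_subset (isClosed_tsupport _) tsupport_field_subset
  obtain ⟨M, hM⟩ := hc.bounded_above_of_compact_support hsupp
  refine ⟨2 * |M| + 1, by positivity, fun q => ?_⟩
  have h := hM q
  rw [Prod.norm_def] at h
  have h1 : |(field q).1| ≤ |M| := (le_max_left _ _).trans (h.trans (le_abs_self M))
  have h2 : |(field q).2| ≤ |M| := (le_max_right _ _).trans (h.trans (le_abs_self M))
  have h1' : (field q).1 ^ 2 ≤ |M| ^ 2 := by
    rw [← sq_abs ((field q).1)]; exact pow_le_pow_left₀ (abs_nonneg _) h1 2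
  have h2' : (field q).2 ^ 2 ≤ |M| ^ 2 := by
    rw [← sq_abs ((field q).2)]; exact pow_le_pow_left₀ (abs_nonneg _) h2 2
  nlinarith [abs_nonneg M]

end BaseField

/-! ### The stack `U ∪ U^{α₁,ρ₁} ∪ U^{α₂,ρ₂}` -/

/-- The stacked set `U ∪ U^{a',r'} ∪ U^{a'',r''}` of §5.2. [cite: Ozanski2017NSISingular, §5.2 (5.12)] -/
def stackSet (U : Set (ℝ × ℝ)) (α₁ ρ₁ α₂ ρ₂ : ℝ) : Set (ℝ × ℝ) :=
  U ∪ copySet α₁ ρ₁ U ∪ copySet α₂ ρ₂ U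

/-- The stacked field `v + v^{a',r',s'} + v^{a'',r'',s''}` of (5.13). [cite: Ozanski2017NSISingular, §5.2 (5.13)] -/
def stackVec (v : ℝ × ℝ → ℝ × ℝ) (α₁ ρ₁ σ₁ α₂ ρ₂ σ₂ : ℝ) : ℝ × ℝ → ℝ × ℝ :=
  v + copyVec α₁ ρ₁ σ₁ v + copyVec α₂ ρ₂ σ₂ v

/-- The stacked scalar `g + g^{a',r',s'} + g^{a'',r'',s''}` of (5.13) (`f`, and `φ` with unit
amplitudes). [cite: Ozanski2017NSISingular, §5.2 (5.13)] -/
def stackFun (g : ℝ × ℝ → ℝ) (α₁ ρ₁ σ₁ α₂ ρ₂ σ₂ : ℝ) : ℝ × ℝ → ℝ :=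
  g + copyFun α₁ ρ₁ σ₁ g + copyFun α₂ ρ₂ σ₂ g

section Stack

variable {U : Set (ℝ × ℝ)} {v : ℝ × ℝ → ℝ × ℝ} {f φ : ℝ × ℝ → ℝ}

/-- Radial range of a copy: if `Ū ⊆ {a ≤ r ≤ b}` then `closure (U^{α,ρ}) ⊆ {ρa ≤ r ≤ ρb}`. [folklore] -/
theorem closure_copySet_fst_mem {a b : ℝ} (hU : ∀ q ∈ closure U, a ≤ q.1 ∧ q.1 ≤ b) (α : ℝ) {ρ : ℝ}
    (hρ : 0 < ρ) {q : ℝ × ℝ} (hq : q ∈ closure (copySet α ρ U)) : ρ * a ≤ q.1 ∧ q.1 ≤ ρ * b := by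
  rw [closure_copySet α hρ.ne'] at hq
  have h := hU _ hq
  simp only [copyInv_apply] at h
  rw [le_div_iff₀ hρ, div_le_iff₀ hρ] at h
  constructor <;> nlinarith [h.1, h.2]

/-- Sets living in disjoint radial ranges have disjoint closures. [folklore] -/
theorem disjoint_of_fst_ranges {A B : Set (ℝ × ℝ)} {a b c d : ℝ} (hA : ∀ q ∈ closure A, a ≤ q.1 ∧ q.1 ≤ b)
    (hB : ∀ q ∈ closure B, c ≤ q.1 ∧ q.1 ≤ d) (hbc : b < c) : Disjoint (closure A) (closure B) :=
  disjoint_left.2 fun q hqA hqB => by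
    have h1 := (hA q hqA).2
    have h2 := (hB q hqB).1
    linarith

/-- The sup norm of an axis point: `‖(0, t)‖ = |t|`. [folklore] -/
theorem norm_zero_mk (t : ℝ) : ‖((0 : ℝ), t)‖ = |t| := by
  rw [Prod.norm_def]; simp

/-- `‖copyInv α ρ q‖ = ‖q - (0, α)‖ / ρ` (`ρ > 0`). [folklore] -/
theorem norm_copyInv (α : ℝ) {ρ : ℝ} (hρ : 0 < ρ) (q : ℝ × ℝ) :
    ‖copyInv α ρ q‖ = ‖q - ((0 : ℝ), α)‖ / ρ := by
  have h : copyInv α ρ q = ρ⁻¹ • (q - ((0 : ℝ), α)) := by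
    obtain ⟨r, z⟩ := q
    simp only [copyInv_apply, Prod.smul_mk, smul_eq_mul, Prod.mk_sub_mk, sub_zero, Prod.mk.injEq]
    constructor <;> ring
  rw [h, norm_smul, Real.norm_eq_abs, abs_of_pos (inv_pos.2 hρ), div_eq_inv_mul]

/-- **The small-copy lemma** (Ożański §5.2: "take `r' > 0` so small that
`|F₁^{0,r',s'}(x₁,0)| < 0.001B` for `x₁` such that `F₁(A+x₁,0) < 0.999B`"): a profile `g` with
`|g(t)| ≤ C/|t|⁴` becomes, after the similarity `t = (s - A(1-ρ₁))/ρ₁` fixing `A` and any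
amplification `λ`, smaller than any `tol > 0` outside the `δ₀`-neighbourhood of `A`, once `ρ₁` is
small. [cite: Ozanski2017NSISingular, §5.2 (the choice of r', r'')] -/
theorem exists_small_copy {g : ℝ → ℝ} {C : ℝ} (hC0 : 0 ≤ C) (hC : ∀ t : ℝ, t ≠ 0 → |g t| ≤ C / |t| ^ 4)
    (A : ℝ) {δ₀ tol lam ρmax : ℝ} (hδ₀ : 0 < δ₀) (htol : 0 < tol) (hlam : 0 < lam) (hρmax : 0 < ρmax) :
    ∃ ρ₁ : ℝ, 0 < ρ₁ ∧ ρ₁ ≤ ρmax ∧ ρ₁ ≤ 1 ∧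
      ∀ s : ℝ, δ₀ ≤ |s - A| → |lam * g ((s - A * (1 - ρ₁)) / ρ₁)| ≤ tol := by
  set ρ₁ : ℝ := min (min ρmax 1) (min (δ₀ / (2 * |A| + 1)) (tol * δ₀ ^ 4 / (16 * C * lam + 1)))
    with hρ₁
  have hpos : 0 < ρ₁ := by positivity
  have h1 : ρ₁ ≤ ρmax := (min_le_left _ _).trans (min_le_left _ _)
  have h2 : ρ₁ ≤ 1 := (min_le_left _ _).trans (min_le_right _ _)
  have h3 : ρ₁ ≤ δ₀ / (2 * |A| + 1) := (min_le_right _ _).trans (min_le_left _ _)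
  have h4 : ρ₁ ≤ tol * δ₀ ^ 4 / (16 * C * lam + 1) := (min_le_right _ _).trans (min_le_right _ _)
  refine ⟨ρ₁, hpos, h1, h2, fun s hs => ?_⟩
  set t : ℝ := (s - A * (1 - ρ₁)) / ρ₁ with ht
  -- `|t| ≥ δ₀/(2ρ₁)`
  have hA : |A| * ρ₁ ≤ δ₀ / 2 := by
    have := (le_div_iff₀ (by positivity : (0 : ℝ) < 2 * |A| + 1)).1 h3
    nlinarith [abs_nonneg A]
  have htt : t = (s - A) / ρ₁ + A := by rw [ht]; field_simp; ring
  have ht1 : δ₀ / (2 * ρ₁) ≤ |t| := by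
    have e1 : |(s - A) / ρ₁| = |s - A| / ρ₁ := by rw [abs_div, abs_of_pos hpos]
    have e2 : |s - A| / ρ₁ - |A| ≤ |t| := by
      rw [htt, ← e1]
      have := abs_add_le ((s - A) / ρ₁ + A) (-A)
      rw [add_neg_cancel_right, abs_neg] at this
      linarith
    have e3 : δ₀ / ρ₁ ≤ |s - A| / ρ₁ := div_le_div_of_nonneg_right hs hpos.le
    have e4 : |A| ≤ δ₀ / (2 * ρ₁) := by
      rw [le_div_iff₀ (by positivity)]; linarith
    have e5 : δ₀ / ρ₁ = δ₀ / (2 * ρ₁) + δ₀ / (2 * ρ₁) := by field_simp; ring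
    linarith
  have htpos : 0 < |t| := lt_of_lt_of_le (by positivity) ht1
  have ht0 : t ≠ 0 := abs_pos.1 htpos
  -- `|g t| ≤ C (2ρ₁/δ₀)⁴ ≤ 16 C ρ₁ / δ₀⁴`
  have hg : |g t| ≤ 16 * C * ρ₁ / δ₀ ^ 4 := by
    refine (hC t ht0).trans ?_
    have hp : (δ₀ / (2 * ρ₁)) ^ 4 ≤ |t| ^ 4 := pow_le_pow_left₀ (by positivity) ht1 4
    calc C / |t| ^ 4 ≤ C / (δ₀ / (2 * ρ₁)) ^ 4 := div_le_div_of_nonneg_left hC0 (by positivity) hp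
      _ = 16 * C * ρ₁ ^ 4 / δ₀ ^ 4 := by field_simp; ring
      _ ≤ 16 * C * ρ₁ / δ₀ ^ 4 := by
          refine div_le_div_of_nonneg_right ?_ (by positivity)
          have : ρ₁ ^ 4 ≤ ρ₁ := by
            calc ρ₁ ^ 4 ≤ ρ₁ ^ 1 := pow_le_pow_of_le_one hpos.le h2 (by norm_num)
              _ = ρ₁ := pow_one ρ₁
          nlinarith
  rw [abs_mul, abs_of_pos hlam]
  have h5 : 16 * C * lam * ρ₁ ≤ tol * δ₀ ^ 4 := by
    have := (le_div_iff₀ (by positivity : (0 : ℝ) < 16 * C * lam + 1)).1 h4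
    nlinarith [mul_nonneg (mul_nonneg (by norm_num : (0 : ℝ) ≤ 16) hC0) hlam.le]
  calc lam * |g t| ≤ lam * (16 * C * ρ₁ / δ₀ ^ 4) := mul_le_mul_of_nonneg_left hg hlam.le
    _ = 16 * C * lam * ρ₁ / δ₀ ^ 4 := by ring
    _ ≤ tol * δ₀ ^ 4 / δ₀ ^ 4 := div_le_div_of_nonneg_right h5 (by positivity)
    _ = tol := by field_simp

namespace IsNSIStructure

/-- **The stack is a structure** with `F = F + F₁ + F₂`, for `0 < ρ₁ ≤ 1/8`, `0 < ρ₂ ≤ ρ₁/8`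
(radially separated copies: `Ū ⊆ {1/8 ≤ r ≤ 7/8}`, `closure U^{α₁,ρ₁} ⊆ {ρ₁/8 ≤ r ≤ 7ρ₁/8}`,
`closure U^{α₂,ρ₂} ⊆ {ρ₂/8 ≤ r ≤ 7ρ₂/8}`; Ożański: "`r' < 1/8` and `r'' < r'/8` suffices").
[cite: Ozanski2017NSISingular, §5.2 (5.12)–(5.13) and footnote on r', r''] -/
theorem stack (h : IsNSIStructure U v f φ) (hU : ∀ q ∈ closure U, 1 / 8 ≤ q.1 ∧ q.1 ≤ 7 / 8)
    (α₁ α₂ : ℝ) {ρ₁ σ₁ ρ₂ σ₂ : ℝ} (hρ₁ : 0 < ρ₁) (hρ₁' : ρ₁ ≤ 1 / 8) (hσ₁ : 0 < σ₁) (hρ₂ : 0 < ρ₂)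
    (hρ₂' : ρ₂ ≤ ρ₁ / 8) (hσ₂ : 0 < σ₂) :
    IsNSIStructure (stackSet U α₁ ρ₁ α₂ ρ₂) (stackVec v α₁ ρ₁ σ₁ α₂ ρ₂ σ₂)
        (stackFun f α₁ ρ₁ σ₁ α₂ ρ₂ σ₂) (stackFun φ α₁ ρ₁ 1 α₂ ρ₂ 1) ∧
      pressureInteraction (stackVec v α₁ ρ₁ σ₁ α₂ ρ₂ σ₂) (stackFun f α₁ ρ₁ σ₁ α₂ ρ₂ σ₂) =
        (fun q => pressureInteraction v f q + (σ₁ ^ 2 / ρ₁) • pressureInteraction v f (copyInv α₁ ρ₁ q) +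
          (σ₂ ^ 2 / ρ₂) • pressureInteraction v f (copyInv α₂ ρ₂ q)) ∧
      (∀ q ∈ closure (stackSet U α₁ ρ₁ α₂ ρ₂), ρ₂ / 8 ≤ q.1 ∧ q.1 ≤ 7 / 8) := by
  have h₁ := h.copy α₁ hρ₁ hσ₁
  have h₂ := h.copy α₂ hρ₂ hσ₂
  have hU₁ : ∀ q ∈ closure (copySet α₁ ρ₁ U), ρ₁ * (1 / 8) ≤ q.1 ∧ q.1 ≤ ρ₁ * (7 / 8) :=
    fun q hq => closure_copySet_fst_mem hU α₁ hρ₁ hq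
  have hU₂ : ∀ q ∈ closure (copySet α₂ ρ₂ U), ρ₂ * (1 / 8) ≤ q.1 ∧ q.1 ≤ ρ₂ * (7 / 8) :=
    fun q hq => closure_copySet_fst_mem hU α₂ hρ₂ hq
  have hd01 : Disjoint (closure U) (closure (copySet α₁ ρ₁ U)) :=
    (disjoint_of_fst_ranges hU₁ hU (by nlinarith)).symm
  have h01 := h.add h₁ hd01
  have hU01 : ∀ q ∈ closure (U ∪ copySet α₁ ρ₁ U), ρ₁ * (1 / 8) ≤ q.1 ∧ q.1 ≤ 7 / 8 := by
    intro q hq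
    rw [closure_union] at hq
    rcases hq with hq | hq
    · have := hU q hq; constructor <;> nlinarith [this.1, this.2]
    · have := hU₁ q hq; constructor <;> nlinarith [this.1, this.2]
  have hd012 : Disjoint (closure (U ∪ copySet α₁ ρ₁ U)) (closure (copySet α₂ ρ₂ U)) :=
    (disjoint_of_fst_ranges hU₂ hU01 (by nlinarith)).symm
  have h012 := h01.add h₂ hd012
  refine ⟨h012, ?_, fun q hq => ?_⟩
  · rw [stackVec, stackFun, h01.pressureInteraction_add h₂ hd012, h.pressureInteraction_add h₁ hd01,
      h.pressureInteraction_copy α₁ hρ₁ hσ₁.le, h.pressureInteraction_copy α₂ hρ₂ hσ₂.le]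
    rfl
  · rw [stackSet, closure_union] at hq
    rcases hq with hq | hq
    · have := hU01 q hq; constructor <;> nlinarith [this.1, this.2]
    · have := hU₂ q hq; constructor <;> nlinarith [this.1, this.2]

end IsNSIStructure

end Stack

/-! ### §5.2 (i)–(vi): the joint pressure interaction function `H` -/

section Main

variable {U : Set (ℝ × ℝ)} {v : ℝ × ℝ → ℝ × ℝ} {f φ : ℝ × ℝ → ℝ}

/-- `|p.2| ≤ ‖p‖` for the sup norm. [folklore] -/
theorem abs_snd_le_norm (p : ℝ × ℝ) : |p.2| ≤ ‖p‖ := by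
  rw [← Real.norm_eq_abs]; exact norm_snd_le p

/-- `-‖p‖ ≤ p.2`. [folklore] -/
theorem neg_norm_le_snd (p : ℝ × ℝ) : -‖p‖ ≤ p.2 := by
  have := abs_snd_le_norm p; have := neg_abs_le p.2; linarith

/-- **The two-level stack on the axis** (Ożański §5.2, the choice of `r', s', a', r'', s'', a''`
giving (i) `H₁(A,0) = 7B` and (ii) `H₁(x₁,0) ≥ -1.005B`): for a continuous profile `g` with
`-B ≤ g`, `B = g(A) > 0` and `|g(t)| ≤ C/|t|⁴` there are scales `0 < ρ₁ ≤ 1/8`, `0 < ρ₂ ≤ ρ₁/8` such that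
`g + 2g∘T₁ + 4g∘T₂`, `T_j(s) = (s - A(1-ρ_j))/ρ_j`, equals `7B` at `A` and is `≥ -1.005B`
everywhere. [cite: Ozanski2017NSISingular, §5.2 (i)–(ii)] -/
theorem exists_two_level_profile {g : ℝ → ℝ} {A B C : ℝ} (hgc : Continuous g) (hB : 0 < B)
    (hC : 0 ≤ C) (hgA : g A = B) (hgge : ∀ s, -B ≤ g s)
    (hgC : ∀ t : ℝ, t ≠ 0 → |g t| ≤ C / |t| ^ 4) :
    ∃ ρ₁ ρ₂ : ℝ, 0 < ρ₁ ∧ ρ₁ ≤ 1 / 8 ∧ 0 < ρ₂ ∧ ρ₂ ≤ ρ₁ / 8 ∧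
      g A + 2 * g ((A - A * (1 - ρ₁)) / ρ₁) + 4 * g ((A - A * (1 - ρ₂)) / ρ₂) = 7 * B ∧
      ∀ s : ℝ, -(1005 / 1000) * B ≤
        g s + 2 * g ((s - A * (1 - ρ₁)) / ρ₁) + 4 * g ((s - A * (1 - ρ₂)) / ρ₂) := by
  -- Level 1
  obtain ⟨δ₀, hδ₀, hcont₀⟩ := Metric.continuous_iff.1 hgc A (B / 1000) (by positivity)
  obtain ⟨ρ₁, hρ₁, hρ₁8, hρ₁1, hsmall₁⟩ := exists_small_copy hC hgC A hδ₀
    (by positivity : (0 : ℝ) < B / 1000) (by norm_num : (0 : ℝ) < 2) (by norm_num : (0 : ℝ) < 1 / 8)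
  have hT₁A : (A - A * (1 - ρ₁)) / ρ₁ = A := by field_simp; ring
  set g₁ : ℝ → ℝ := fun s => 2 * g ((s - A * (1 - ρ₁)) / ρ₁) with hg₁def
  have hg₁ge : ∀ s, -(2 * B) ≤ g₁ s := fun s => by
    have := hgge ((s - A * (1 - ρ₁)) / ρ₁); simp only [hg₁def]; linarith
  have hnear₀ : ∀ s, |s - A| < δ₀ → B * (999 / 1000) < g s := fun s hs => by
    have h1 := hcont₀ s (by rwa [Real.dist_eq])
    rw [Real.dist_eq, hgA] at h1
    have h2 := (abs_lt.1 h1).1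
    linarith
  have hS₁ge : ∀ s, -(1001 / 1000) * B ≤ g s + g₁ s := fun s => by
    rcases lt_or_ge |s - A| δ₀ with hs | hs
    · have := hnear₀ s hs; have := hg₁ge s; linarith
    · have := hgge s; have h2 := hsmall₁ s hs; have := neg_abs_le (g₁ s)
      change |g₁ s| ≤ B / 1000 at h2
      linarith
  have hS₁A : g A + g₁ A = 3 * B := by simp only [hg₁def, hT₁A, hgA]; ring
  have hS₁c : Continuous fun s => g s + g₁ s :=
    hgc.add (continuous_const.mul (hgc.comp ((continuous_id.sub continuous_const).div_const _)))
  -- Level 2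
  obtain ⟨δ₁, hδ₁, hcont₁⟩ := Metric.continuous_iff.1 hS₁c A (3 * B / 1000) (by positivity)
  obtain ⟨ρ₂, hρ₂, hρ₂8, -, hsmall₂⟩ := exists_small_copy hC hgC A hδ₁
    (by positivity : (0 : ℝ) < B / 1000) (by norm_num : (0 : ℝ) < 4) (by positivity : (0 : ℝ) < ρ₁ / 8)
  have hT₂A : (A - A * (1 - ρ₂)) / ρ₂ = A := by field_simp; ring
  set g₂ : ℝ → ℝ := fun s => 4 * g ((s - A * (1 - ρ₂)) / ρ₂) with hg₂def
  have hg₂ge : ∀ s, -(4 * B) ≤ g₂ s := fun s => by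
    have := hgge ((s - A * (1 - ρ₂)) / ρ₂); simp only [hg₂def]; linarith
  have hnear₁ : ∀ s, |s - A| < δ₁ → 3 * B * (999 / 1000) < g s + g₁ s := fun s hs => by
    have h1 := hcont₁ s (by rwa [Real.dist_eq])
    rw [Real.dist_eq, hS₁A] at h1
    have h2 := (abs_lt.1 h1).1
    linarith
  refine ⟨ρ₁, ρ₂, hρ₁, hρ₁8, hρ₂, hρ₂8, ?_, fun s => ?_⟩
  · rw [hT₁A, hT₂A, hgA]; ring
  · change -(1005 / 1000) * B ≤ g s + g₁ s + g₂ s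
    rcases lt_or_ge |s - A| δ₁ with hs | hs
    · have := hnear₁ s hs; have := hg₂ge s; linarith
    · have := hS₁ge s; have h2 := hsmall₂ s hs; have := neg_abs_le (g₂ s)
      change |g₂ s| ≤ B / 1000 at h2
      linarith

/-- **Decay of the stack** (§5.2 (iii): `|H(x)| ≤ 2C/|x|⁴` for `|x| > 2|A|`): each copy contributes
`≤ 16 λ_j ρ_j⁴ C/|q|⁴ ≤ C/(2|q|⁴)`. [cite: Ozanski2017NSISingular, §5.2 (iii)] -/
theorem norm_stack_le {F : ℝ × ℝ → ℝ × ℝ} {A C α₁ ρ₁ α₂ ρ₂ : ℝ} (hC : 0 ≤ C) (hA : A ≠ 0)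
    (hdec : ∀ q : ℝ × ℝ, q ≠ 0 → ‖F q‖ ≤ C / ‖q‖ ^ 4) (hρ₁ : 0 < ρ₁) (hρ₁' : ρ₁ ≤ 1 / 8)
    (hρ₂ : 0 < ρ₂) (hρ₂' : ρ₂ ≤ 1 / 64) (hα₁ : |α₁| ≤ |A|) (hα₂ : |α₂| ≤ |A|) {q : ℝ × ℝ}
    (hq : 2 * |A| ≤ ‖q‖) :
    ‖F q + (2 : ℝ) • F (copyInv α₁ ρ₁ q) + (4 : ℝ) • F (copyInv α₂ ρ₂ q)‖ ≤ 2 * C / ‖q‖ ^ 4 := by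
  have hApos : 0 < |A| := abs_pos.2 hA
  have hq0 : 0 < ‖q‖ := by linarith
  have hqne : q ≠ 0 := norm_pos_iff.1 hq0
  have bound : ∀ {α ρ lam : ℝ}, 0 < ρ → |α| ≤ |A| → 0 ≤ lam → 16 * lam * ρ ^ 4 ≤ 1 / 2 →
      ‖lam • F (copyInv α ρ q)‖ ≤ (C / 2) / ‖q‖ ^ 4 := by
    intro α ρ lam hρ hα hlam hsmall
    have hn : ‖q‖ / 2 / ρ ≤ ‖copyInv α ρ q‖ := by
      rw [norm_copyInv α hρ q]
      refine div_le_div_of_nonneg_right ?_ hρ.le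
      have h1 : ‖q‖ ≤ ‖q - ((0 : ℝ), α)‖ + ‖((0 : ℝ), α)‖ := norm_le_norm_sub_add q _
      rw [norm_zero_mk] at h1
      linarith
    have hpos : 0 < ‖q‖ / 2 / ρ := by positivity
    have hcq : copyInv α ρ q ≠ 0 := norm_pos_iff.1 (hpos.trans_le hn)
    have h1 := hdec _ hcq
    rw [norm_smul, Real.norm_eq_abs, abs_of_nonneg hlam]
    calc lam * ‖F (copyInv α ρ q)‖ ≤ lam * (C / ‖copyInv α ρ q‖ ^ 4) := mul_le_mul_of_nonneg_left h1 hlam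
      _ ≤ lam * (C / (‖q‖ / 2 / ρ) ^ 4) := by
          refine mul_le_mul_of_nonneg_left (div_le_div_of_nonneg_left hC (by positivity) ?_) hlam
          exact pow_le_pow_left₀ hpos.le hn 4
      _ = (16 * lam * ρ ^ 4) * C / ‖q‖ ^ 4 := by field_simp; ring
      _ ≤ (1 / 2) * C / ‖q‖ ^ 4 :=
          div_le_div_of_nonneg_right (mul_le_mul_of_nonneg_right hsmall hC) (by positivity)
      _ = (C / 2) / ‖q‖ ^ 4 := by ring
  have hs₁ : 16 * (2 : ℝ) * ρ₁ ^ 4 ≤ 1 / 2 := by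
    have : ρ₁ ^ 4 ≤ (1 / 8 : ℝ) ^ 4 := pow_le_pow_left₀ hρ₁.le hρ₁' 4
    nlinarith
  have hs₂ : 16 * (4 : ℝ) * ρ₂ ^ 4 ≤ 1 / 2 := by
    have : ρ₂ ^ 4 ≤ (1 / 64 : ℝ) ^ 4 := pow_le_pow_left₀ hρ₂.le hρ₂' 4
    nlinarith
  have b₀ := hdec q hqne
  have b₁ := bound hρ₁ hα₁ (by norm_num) hs₁
  have b₂ := bound hρ₂ hα₂ (by norm_num) hs₂
  calc _ ≤ ‖F q + (2 : ℝ) • F (copyInv α₁ ρ₁ q)‖ + ‖(4 : ℝ) • F (copyInv α₂ ρ₂ q)‖ := norm_add_le _ _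
    _ ≤ ‖F q‖ + ‖(2 : ℝ) • F (copyInv α₁ ρ₁ q)‖ + ‖(4 : ℝ) • F (copyInv α₂ ρ₂ q)‖ := by
        gcongr; exact norm_add_le _ _
    _ ≤ C / ‖q‖ ^ 4 + C / 2 / ‖q‖ ^ 4 + C / 2 / ‖q‖ ^ 4 := add_le_add (add_le_add b₀ b₁) b₂
    _ = 2 * C / ‖q‖ ^ 4 := by ring

/-- **The strip below the stack** (§5.2 (iv)–(vi), "by continuity … there exists `E > 0`"): for a
continuous `H` with `H_axial ≥ -1.005B` on the axis, `H_axial(0,A) = 7B` and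
`|H(q)| ≤ 2C/|q|⁴` for `|q| ≥ 2|A|`, and any `κ > 0`, `ρ₂ > 0`, there is `E ∈ (0, ρ₂/8)`, `E ≤ 1/2`,
with (v) `H_axial ≥ -1.01B` on `{0 ≤ r < E}` and (vi) `H_axial ≥ 6.99B` on
`{|z - A| ≤ κE, 0 ≤ r < E}` (uniform continuity on `[0,1] × [-R₀,R₀]` and the decay beyond `R₀`).
[cite: Ozanski2017NSISingular, §5.2 (iv)–(vi)] -/
theorem exists_strip {H : ℝ × ℝ → ℝ × ℝ} {A B C : ℝ} (hHc : Continuous H) (hB : 0 < B)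
    (haxis : ∀ s : ℝ, -(1005 / 1000) * B ≤ (H (0, s)).2) (hHA : (H (0, A)).2 = 7 * B)
    (hdec : ∀ q : ℝ × ℝ, 2 * |A| ≤ ‖q‖ → ‖H q‖ ≤ 2 * C / ‖q‖ ^ 4) {κ ρ₂ : ℝ} (hκ : 0 < κ)
    (hρ₂ : 0 < ρ₂) :
    ∃ E : ℝ, 0 < E ∧ E < ρ₂ / 8 ∧ E ≤ 1 / 2 ∧
      (∀ q : ℝ × ℝ, 0 ≤ q.1 → q.1 < E → -(101 / 100) * B ≤ (H q).2) ∧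
      (∀ q : ℝ × ℝ, |q.2 - A| ≤ κ * E → 0 ≤ q.1 → q.1 < E → (699 / 100) * B ≤ (H q).2) := by
  -- far out, `H_axial ≥ -B`
  set R₀ : ℝ := max (2 * |A|) (max 1 (2 * C / B)) with hR₀
  have hfar : ∀ q : ℝ × ℝ, R₀ ≤ ‖q‖ → -B ≤ (H q).2 := by
    intro q hq
    have h2A : 2 * |A| ≤ ‖q‖ := (le_max_left _ _).trans hq
    have h1 : 1 ≤ ‖q‖ := ((le_max_left _ _).trans (le_max_right _ _)).trans hq
    have hCB : 2 * C / B ≤ ‖q‖ := ((le_max_right _ _).trans (le_max_right _ _)).trans hq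
    have hq4 : ‖q‖ ≤ ‖q‖ ^ 4 := by
      calc ‖q‖ = ‖q‖ ^ 1 := (pow_one _).symm
        _ ≤ ‖q‖ ^ 4 := pow_le_pow_right₀ h1 (by norm_num)
    have hb : 2 * C / ‖q‖ ^ 4 ≤ B := by
      rw [div_le_iff₀ (by positivity)]
      have := (div_le_iff₀ hB).1 hCB
      nlinarith
    have := neg_norm_le_snd (H q)
    have := hdec q h2A
    linarith
  -- uniform continuity of `H` on the compact `K₀ = [0,1] × [-R₀, R₀]`
  have hK₀ : IsCompact (Icc (0 : ℝ) 1 ×ˢ Icc (-R₀) R₀) := isCompact_Icc.prod isCompact_Icc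
  obtain ⟨η₀, hη₀, hunif⟩ := Metric.uniformContinuousOn_iff.1
    (hK₀.uniformContinuousOn_of_continuous hHc.continuousOn) (B / 200) (by positivity)
  -- continuity of `H` at `(0, A)`
  obtain ⟨η₁, hη₁, hcontA⟩ := Metric.continuous_iff.1 hHc ((0 : ℝ), A) (B / 100) (by positivity)
  set E : ℝ := min (min (ρ₂ / 16) (η₀ / 2)) (min (η₁ / (2 * (κ + 1))) (1 / 2)) with hE
  have hEpos : 0 < E := by positivity
  have hE₁ : E ≤ ρ₂ / 16 := (min_le_left _ _).trans (min_le_left _ _)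
  have hE₂ : E ≤ η₀ / 2 := (min_le_left _ _).trans (min_le_right _ _)
  have hE₃ : E ≤ η₁ / (2 * (κ + 1)) := (min_le_right _ _).trans (min_le_left _ _)
  have hE₄ : E ≤ 1 / 2 := (min_le_right _ _).trans (min_le_right _ _)
  refine ⟨E, hEpos, by linarith, hE₄, fun q hq0 hqE => ?_, fun q hqA hq0 hqE => ?_⟩
  · -- (v)
    rcases le_or_gt R₀ |q.2| with hz | hz
    · have hn : R₀ ≤ ‖q‖ := hz.trans (abs_snd_le_norm q)
      have := hfar q hn
      linarith
    · have hz' := abs_lt.1 hz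
      have hqK : q ∈ Icc (0 : ℝ) 1 ×ˢ Icc (-R₀) R₀ :=
        ⟨⟨hq0, by linarith⟩, ⟨by linarith, by linarith⟩⟩
      have hpK : ((0 : ℝ), q.2) ∈ Icc (0 : ℝ) 1 ×ˢ Icc (-R₀) R₀ :=
        ⟨⟨le_rfl, zero_le_one⟩, ⟨by linarith, by linarith⟩⟩
      have hdist : dist q ((0 : ℝ), q.2) < η₀ := by
        rw [Prod.dist_eq, Real.dist_eq, Real.dist_eq, sub_zero, sub_self, abs_zero, abs_of_nonneg hq0]
        rw [max_lt_iff]; constructor <;> linarith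
      have h1 := hunif q hqK _ hpK hdist
      rw [Prod.dist_eq, max_lt_iff, Real.dist_eq, Real.dist_eq] at h1
      have h2 := (abs_lt.1 h1.2).1
      have h3 := haxis q.2
      linarith
  · -- (vi)
    have hdist : dist q ((0 : ℝ), A) < η₁ := by
      rw [Prod.dist_eq, Real.dist_eq, Real.dist_eq, sub_zero, abs_of_nonneg hq0, max_lt_iff]
      have hη₁' : η₁ / (2 * (κ + 1)) * (2 * (κ + 1)) = η₁ := by field_simp
      constructor
      · nlinarith
      · nlinarith
    have h1 := hcontA q hdist
    rw [Prod.dist_eq, max_lt_iff, Real.dist_eq, Real.dist_eq, hHA] at h1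
    have h2 := (abs_lt.1 h1.2).1
    linarith

/-- **Ożański 2017, §5.2 (i)–(vi): the stack `H = F + F^{a',r',s'} + F^{a'',r'',s''}`.** Let
`(v,f,φ)` be a structure on `U` with `Ū ⊆ {1/8 ≤ r ≤ 7/8}` (e.g. `U = (1/8,7/8) × (-1,1)`), with
`F_axial` odd on the axis ((5.4)) and `v_z ≢ 0`; let `A, B` be the point and value of the positive
maximum of `F_axial` on the axis (Lemma 3.5 (ii)) and `C` the decay constant (Lemma 3.5 (iii)).
Then there are copies `U^{α₁,ρ₁}`, `U^{α₂,ρ₂}` (`α_j = A(1-ρ_j)`, `0 < ρ₁ ≤ 1/8`,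
`0 < ρ₂ ≤ ρ₁/8`) with amplitudes `σ₁²/ρ₁ = 2`, `σ₂²/ρ₂ = 4` such that the stack is a structure
with `Ū_stack ⊆ {ρ₂/8 ≤ r ≤ 7/8}` and its pressure interaction function
`H = F + 2F∘copyInv₁ + 4F∘copyInv₂` satisfies **(i)** `H_axial(0,A) = 7B`, **(ii)**
`H_axial(0,s) ≥ -1.005B`, **(iii)** `|H(q)| ≤ 2C/|q|⁴` for `|q| ≥ 2|A|`, and for every `κ > 0` there
is `E ∈ (0, ρ₂/8)`, `E ≤ 1/2`, with **(iv)** (the strip `{0 < r < E}` lies below the stack),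
**(v)** `H_axial ≥ -1.01B` on `{0 ≤ r < E}`, **(vi)** `H_axial ≥ 6.99B` on
`{|z - A| ≤ κE, 0 ≤ r < E}`. (Printed with `r'`, `r''`, `s'`, `s''`, `a'`, `a''`; sup norm on `ℝ²`
here, immaterial as `C` is the existential constant of Lemma 3.5 (iii).)
[cite: Ozanski2017NSISingular, §5.2 (i)–(vi)] [cite: Scheffer1987, §4 (Lemmas 4.1–4.6)] -/
theorem exists_interactionStack (h : IsNSIStructure U v f φ)
    (hU : ∀ q ∈ closure U, 1 / 8 ≤ q.1 ∧ q.1 ≤ 7 / 8)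
    (hodd : ∀ s : ℝ, (pressureInteraction v f (0, -s)).2 = -(pressureInteraction v f (0, s)).2)
    (hv : ∃ q, (v q).2 ≠ 0) :
    ∃ A B C α₁ ρ₁ σ₁ α₂ ρ₂ σ₂ : ℝ,
      0 < B ∧ 0 < C ∧ A ≠ 0 ∧ 0 < ρ₁ ∧ ρ₁ ≤ 1 / 8 ∧ 0 < σ₁ ∧ 0 < ρ₂ ∧ ρ₂ ≤ ρ₁ / 8 ∧ 0 < σ₂ ∧
      σ₁ ^ 2 / ρ₁ = 2 ∧ σ₂ ^ 2 / ρ₂ = 4 ∧ α₁ = A * (1 - ρ₁) ∧ α₂ = A * (1 - ρ₂) ∧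
      (pressureInteraction v f (0, A)).2 = B ∧ (∀ s : ℝ, (pressureInteraction v f (0, s)).2 ≤ B) ∧
      (∀ q : ℝ × ℝ, q ≠ 0 → ‖pressureInteraction v f q‖ ≤ C / ‖q‖ ^ 4 ∧
        ‖fderiv ℝ (pressureInteraction v f) q‖ ≤ C / ‖q‖ ^ 5) ∧
      IsNSIStructure (stackSet U α₁ ρ₁ α₂ ρ₂) (stackVec v α₁ ρ₁ σ₁ α₂ ρ₂ σ₂)
        (stackFun f α₁ ρ₁ σ₁ α₂ ρ₂ σ₂) (stackFun φ α₁ ρ₁ 1 α₂ ρ₂ 1) ∧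
      (∀ q ∈ closure (stackSet U α₁ ρ₁ α₂ ρ₂), ρ₂ / 8 ≤ q.1 ∧ q.1 ≤ 7 / 8) ∧
      pressureInteraction (stackVec v α₁ ρ₁ σ₁ α₂ ρ₂ σ₂) (stackFun f α₁ ρ₁ σ₁ α₂ ρ₂ σ₂) =
        (fun q => pressureInteraction v f q + (2 : ℝ) • pressureInteraction v f (copyInv α₁ ρ₁ q) +
          (4 : ℝ) • pressureInteraction v f (copyInv α₂ ρ₂ q)) ∧
      (pressureInteraction (stackVec v α₁ ρ₁ σ₁ α₂ ρ₂ σ₂) (stackFun f α₁ ρ₁ σ₁ α₂ ρ₂ σ₂) (0, A)).2 =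
        7 * B ∧
      (∀ s : ℝ, -(1005 / 1000) * B ≤
        (pressureInteraction (stackVec v α₁ ρ₁ σ₁ α₂ ρ₂ σ₂) (stackFun f α₁ ρ₁ σ₁ α₂ ρ₂ σ₂) (0, s)).2) ∧
      (∀ q : ℝ × ℝ, 2 * |A| ≤ ‖q‖ →
        ‖pressureInteraction (stackVec v α₁ ρ₁ σ₁ α₂ ρ₂ σ₂) (stackFun f α₁ ρ₁ σ₁ α₂ ρ₂ σ₂) q‖ ≤
          2 * C / ‖q‖ ^ 4) ∧
      (∀ κ : ℝ, 0 < κ → ∃ E : ℝ, 0 < E ∧ E < ρ₂ / 8 ∧ E ≤ 1 / 2 ∧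
        (∀ q : ℝ × ℝ, 0 ≤ q.1 → q.1 < E → -(101 / 100) * B ≤
          (pressureInteraction (stackVec v α₁ ρ₁ σ₁ α₂ ρ₂ σ₂) (stackFun f α₁ ρ₁ σ₁ α₂ ρ₂ σ₂) q).2) ∧
        (∀ q : ℝ × ℝ, |q.2 - A| ≤ κ * E → 0 ≤ q.1 → q.1 < E → (699 / 100) * B ≤
          (pressureInteraction (stackVec v α₁ ρ₁ σ₁ α₂ ρ₂ σ₂) (stackFun f α₁ ρ₁ σ₁ α₂ ρ₂ σ₂) q).2)) := by
  -- Lemma 3.5 (ii), (iii) for the base structure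
  obtain ⟨A, B, hB, hFA, hmax⟩ := h.exists_isMaxOn_pressureInteraction_axis hv
  obtain ⟨C, hC, hdec⟩ := h.exists_pressureInteraction_decay
  set F := pressureInteraction v f with hFdef
  set g : ℝ → ℝ := fun s => (F (0, s)).2 with hgdef
  have hgc : Continuous g := h.continuous_pressureInteraction_axis
  have hgge : ∀ s, -B ≤ g s := fun s => by
    have h1 := hodd s; have h2 := hmax (-s)
    change g (-s) = -g s at h1
    change g (-s) ≤ B at h2
    linarith
  have hA0 : A ≠ 0 := by
    intro hA
    have h1 := hodd 0
    simp only [neg_zero] at h1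
    have h0 : (F (0, 0)).2 = 0 := by linarith
    rw [hA] at hFA; linarith
  have hgC : ∀ t : ℝ, t ≠ 0 → |g t| ≤ C / |t| ^ 4 := fun t ht => by
    have hq : ((0 : ℝ), t) ≠ 0 := fun h0 => ht (by simpa using congrArg Prod.snd h0)
    have := (hdec _ hq).1
    rw [norm_zero_mk] at this
    exact (abs_snd_le_norm _).trans this
  -- the two levels
  obtain ⟨ρ₁, ρ₂, hρ₁, hρ₁8, hρ₂, hρ₂8, hsum, hax⟩ := exists_two_level_profile hgc hB hC.le hFA hgge hgC
  set σ₁ : ℝ := Real.sqrt (2 * ρ₁) with hσ₁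
  have hσ₁pos : 0 < σ₁ := Real.sqrt_pos.2 (by positivity)
  have hσ₁sq : σ₁ ^ 2 / ρ₁ = 2 := by rw [hσ₁, Real.sq_sqrt (by positivity)]; field_simp
  set σ₂ : ℝ := Real.sqrt (4 * ρ₂) with hσ₂
  have hσ₂pos : 0 < σ₂ := Real.sqrt_pos.2 (by positivity)
  have hσ₂sq : σ₂ ^ 2 / ρ₂ = 4 := by rw [hσ₂, Real.sq_sqrt (by positivity)]; field_simp
  -- the stack
  have hρ₂' : ρ₂ ≤ 1 / 64 := hρ₂8.trans (by linarith)
  obtain ⟨hst, hHF, hcl⟩ := h.stack hU (A * (1 - ρ₁)) (A * (1 - ρ₂)) hρ₁ hρ₁8 hσ₁pos hρ₂ hρ₂8 hσ₂pos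
  rw [hσ₁sq, hσ₂sq] at hHF
  set H := pressureInteraction (stackVec v (A * (1 - ρ₁)) ρ₁ σ₁ (A * (1 - ρ₂)) ρ₂ σ₂)
    (stackFun f (A * (1 - ρ₁)) ρ₁ σ₁ (A * (1 - ρ₂)) ρ₂ σ₂) with hHdef
  have hHaxis : ∀ s, (H (0, s)).2 =
      g s + 2 * g ((s - A * (1 - ρ₁)) / ρ₁) + 4 * g ((s - A * (1 - ρ₂)) / ρ₂) := fun s => by
    rw [hHF]
    simp only [Prod.snd_add, Prod.smul_snd, smul_eq_mul, copyInv_apply, zero_div, hgdef]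
    rfl
  have hHA : (H (0, A)).2 = 7 * B := by rw [hHaxis, hsum]
  have hHge : ∀ s, -(1005 / 1000) * B ≤ (H (0, s)).2 := fun s => (hax s).trans (hHaxis s).symm.le
  have hα₁le : |A * (1 - ρ₁)| ≤ |A| := by
    rw [abs_mul, abs_of_nonneg (by linarith : (0 : ℝ) ≤ 1 - ρ₁)]; nlinarith [abs_nonneg A]
  have hα₂le : |A * (1 - ρ₂)| ≤ |A| := by
    rw [abs_mul, abs_of_nonneg (by linarith : (0 : ℝ) ≤ 1 - ρ₂)]; nlinarith [abs_nonneg A]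
  have hiii : ∀ q : ℝ × ℝ, 2 * |A| ≤ ‖q‖ → ‖H q‖ ≤ 2 * C / ‖q‖ ^ 4 := fun q hq => by
    rw [hHF]
    exact norm_stack_le hC.le hA0 (fun q hq => (hdec q hq).1) hρ₁ hρ₁8 hρ₂ hρ₂' hα₁le hα₂le hq
  have hHc : Continuous H := hst.continuous_pressureInteraction
  exact ⟨A, B, C, A * (1 - ρ₁), ρ₁, σ₁, A * (1 - ρ₂), ρ₂, σ₂, hB, hC, hA0, hρ₁, hρ₁8, hσ₁pos, hρ₂, hρ₂8,
    hσ₂pos, hσ₁sq, hσ₂sq, rfl, rfl, hFA, hmax, hdec, hst, hcl, hHF, hHA, hHge, hiii,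
    fun κ hκ => exists_strip hHc hB hHge hHA hiii hκ hρ₂⟩

end Main

end Literature.Barriers.NavierStokesRegularity
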